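import Mathlib.FieldTheory.PurelyInseparable.Basic
import Mathlib.RingTheory.TensorProduct.Finite
import Mathlib.RingTheory.Ideal.Quotient.Operations
-- `FaithfullyFlat.Basic` supplies `Nontrivial (E ⊗[κ] k')` (`Module.FaithfullyFlat.lTensor_nontrivial`),
-- without which `compositumIdeal` (a maximal ideal) cannot be formed:
import Mathlib.RingTheory.Flat.FaithfullyFlat.Basic
import Mathlib.LinearAlgebra.FiniteDimensional.Defs
import HarnessLib

/-!
# A compositum `E·k′` of a field with a purely inseparable extension of a subfield

Topic: `Literature/AlgebraicGeometry/Resolution`. In Step 4 of the proof of Thm. 4.1.1 of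
M. Temkin, *Inseparable local uniformization*, J. Algebra 373 (2013) 65–119 = arXiv:0804.1554v3
(p. 49: "we extend `k̄` as follows: replace `k̄`, `mᵢ`, `K`, `Kᵢ` with `l̄`, `l̄mᵢ`, `l̄K`, `l̄Kᵢ`,
respectively") and in Lemma 2.8.5 (p. 31: "the composite extensions `k′k(X)` … are well defined
since `k′/k(S)` is purely inseparable") composite fields `l̄K₁` of a field `K₁ ⊇ k̄` with a finite
purely inseparable extension `l̄/k̄` are formed. This file CONSTRUCTS such a compositum in
Mathlib's vocabulary, as a quotient of `E ⊗_κ k′` by a maximal ideal (for `k′/κ` purely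
inseparable `E ⊗_κ k′` is local, so the compositum is unique up to unique isomorphism, but
uniqueness is not needed), and proves the properties Step 4 consumes:

* `Compositum κ E k′` — a field with compatible maps `E → E·k′ ← k′` over `κ`;
* finite over `E` when `k′/κ` is finite (`Compositum.finiteDimensional`), purely inseparable over
  `E` when `k′/κ` is (`Compositum.isPurelyInseparable`), and generated over `E` by the image of
  `k′` (`Compositum.adjoin_range_eq_top`).

Everything here is folklore and PROVED.

## Design note

`Compositum.algebraRight : Algebra k′ (Compositum κ E k′)` is a GLOBAL instance although Mathlib
keeps the analogous `Algebra.TensorProduct.rightAlgebra` a non-instance: it is meant for three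
DISTINCT field types `κ`, `E`, `k′` (the situation of Step 4 of Thm. 4.1.1). On the degenerate
instantiations `k′ = κ` or `k′ = E` it shadows the quotient's own `Ideal.Quotient.algebra`
instance by a propositionally equal but not definitionally equal one; do not use `Compositum`
with `k′` syntactically equal to `κ` or `E`.
-/

noncomputable section

open TensorProduct

namespace Literature.AlgebraicGeometry.Resolution

universe u

variable (κ E k' : Type u) [Field κ] [Field E] [Field k'] [Algebra κ E] [Algebra κ k']

/-- A maximal ideal of `E ⊗_κ k′` (any one; for `k′/κ` purely inseparable there is exactly one).
[folklore] -/
def compositumIdeal : Ideal (E ⊗[κ] k') :=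
  Classical.choose (Ideal.exists_maximal (E ⊗[κ] k'))

/-- `compositumIdeal` is maximal. [folklore] -/
instance compositumIdeal_isMaximal : (compositumIdeal κ E k').IsMaximal :=
  Classical.choose_spec (Ideal.exists_maximal (E ⊗[κ] k'))

/-- **A compositum `E·k′`** of the `κ`-fields `E` and `k′`: the residue field of `E ⊗_κ k′` at a
maximal ideal (Temkin 2013, proof of Thm. 4.1.1, Step 4, p. 49: the fields `l̄K`, `l̄Kᵢ`,
`l̄mᵢ`). [folklore] -/
abbrev Compositum : Type u :=
  (E ⊗[κ] k') ⧸ compositumIdeal κ E k'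

namespace Compositum

/-- The compositum is a field. [folklore] -/
instance instField : Field (Compositum κ E k') :=
  Ideal.Quotient.field _

/-- `k′ → E·k′` (a global instance intended for `k′` distinct from `κ` and `E`; see the design
note in the module docstring). [folklore] -/
instance algebraRight : Algebra k' (Compositum κ E k') :=
  ((Ideal.Quotient.mk (compositumIdeal κ E k')).comp
    (Algebra.TensorProduct.includeRight (R := κ) (A := E) (B := k')).toRingHom).toAlgebra

/-- The structure map from `k′`, on elements. [folklore] -/
theorem algebraMap_right_apply (c : k') :
    algebraMap k' (Compositum κ E k') c = Ideal.Quotient.mk _ ((1 : E) ⊗ₜ[κ] c) := rfl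

/-- The structure map from `E`, on elements. [folklore] -/
theorem algebraMap_left_apply (e : E) :
    algebraMap E (Compositum κ E k') e = Ideal.Quotient.mk _ (e ⊗ₜ[κ] (1 : k')) := rfl

/-- `κ → k′ → E·k′` is a tower. [folklore] -/
instance isScalarTower_right : IsScalarTower κ k' (Compositum κ E k') :=
  IsScalarTower.of_algebraMap_eq fun c => by
    rw [algebraMap_right_apply, IsScalarTower.algebraMap_apply κ E (Compositum κ E k'),
      algebraMap_left_apply, Algebra.algebraMap_eq_smul_one, Algebra.algebraMap_eq_smul_one,
      ← TensorProduct.smul_tmul]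

/-- The class of `e ⊗ c` is `e · c`. [folklore] -/
theorem mk_tmul (e : E) (c : k') :
    Ideal.Quotient.mk (compositumIdeal κ E k') (e ⊗ₜ[κ] c) =
      algebraMap E (Compositum κ E k') e * algebraMap k' (Compositum κ E k') c := by
  rw [algebraMap_left_apply, algebraMap_right_apply, ← map_mul, Algebra.TensorProduct.tmul_mul_tmul,
    mul_one, one_mul]

/-- **`E·k′` is generated over `E` by `k′`.** [folklore] -/
theorem adjoin_range_eq_top :
    Algebra.adjoin E (Set.range (algebraMap k' (Compositum κ E k'))) = ⊤ := by
  refine Algebra.eq_top_iff.mpr fun z => ?_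
  obtain ⟨z, rfl⟩ := Ideal.Quotient.mk_surjective z
  induction z using TensorProduct.induction_on with
  | zero => rw [map_zero]; exact Subalgebra.zero_mem _
  | tmul e c =>
    rw [mk_tmul]
    exact Subalgebra.mul_mem _ (Subalgebra.algebraMap_mem _ e)
      (Algebra.subset_adjoin (Set.mem_range_self c))
  | add x y hx hy => rw [map_add]; exact Subalgebra.add_mem _ hx hy

/-- **`E·k′/E` is finite** when `k′/κ` is. [folklore] -/
instance finiteDimensional [FiniteDimensional κ k'] : FiniteDimensional E (Compositum κ E k') :=
  Module.Finite.of_surjective (Ideal.Quotient.mkₐ E (compositumIdeal κ E k')).toLinearMap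
    Ideal.Quotient.mk_surjective

/-- **`E·k′/E` is purely inseparable** when `k′/κ` is (every element has a `qⁿ`-th power in `E`,
by Mathlib's `IsPurelyInseparable.exists_pow_pow_mem_range_tensorProduct_of_expChar`).
[folklore] -/
instance isPurelyInseparable [IsPurelyInseparable κ k'] :
    IsPurelyInseparable E (Compositum κ E k') := by
  obtain ⟨q, hq⟩ := ExpChar.exists κ
  haveI : ExpChar E q := expChar_of_injective_algebraMap (algebraMap κ E).injective q
  rw [isPurelyInseparable_iff_pow_mem E q]
  intro z
  obtain ⟨z, rfl⟩ := Ideal.Quotient.mk_surjective z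
  obtain ⟨n, w, hw⟩ :=
    IsPurelyInseparable.exists_pow_pow_mem_range_tensorProduct_of_expChar (k := κ) (K := k')
      (R := E) q z
  refine ⟨n, w, ?_⟩
  rw [← map_pow, ← hw]
  rfl

/-- Elements of `k′` have `qⁿ`-th powers in `E` inside the compositum. [folklore] -/
theorem exists_pow_mem_range [IsPurelyInseparable κ k'] (q : ℕ) [ExpChar κ q] (c : k') :
    ∃ n : ℕ, ∃ y : κ, algebraMap k' (Compositum κ E k') c ^ q ^ n =
      algebraMap E (Compositum κ E k') (algebraMap κ E y) := by
  obtain ⟨n, y, hy⟩ := IsPurelyInseparable.pow_mem κ q c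
  refine ⟨n, y, ?_⟩
  rw [← IsScalarTower.algebraMap_apply κ E, IsScalarTower.algebraMap_apply κ k' (Compositum κ E k'),
    hy, map_pow]

end Compositum

/-! ### Towers over an intermediate base `κ → E₀ → E` -/

section tower

variable (E₀ : Type u) [Field E₀] [Algebra κ E₀] [Algebra E₀ E] [IsScalarTower κ E₀ E]

/-- Over an intermediate field `κ ⊆ E₀ ⊆ E` (e.g. `k̄ ⊆ K ⊆ K₁`) the compositum is an
`E₀`-algebra through `E` (Mathlib's instances on tensor products and quotients); the structure
map is the composite. [folklore] -/
theorem Compositum.algebraMap_base_apply (x : E₀) :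
    algebraMap E₀ (Compositum κ E k') x = algebraMap E (Compositum κ E k') (algebraMap E₀ E x) :=
  IsScalarTower.algebraMap_apply E₀ E (Compositum κ E k') x

end tower

end Literature.AlgebraicGeometry.Resolution
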